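import Mathlib
import HarnessLib
import HarnessLib.Audit
import Summits.AtomisticToContinuum.Statement

/-!
Route: EntropyBookkeeping

CLOSED (retired) 2026-08-15T13:42:12Z by operator:999:1257524 — reason: not-a-thesis: assembly does not conclude the sub-problem Statement — note: D-0027 §2.1 audit (human 2026-08-15: routes that do not decide the summit are removed): the assembly concludes `Literature.MathematicalPhysics.KineticTheory.HydrodynamicLimit`, not the sub-problem statement; a NEW conforming route may be opened from the same idea (generated `closes : … → _root_.Hydr. The file is kept as the record of this route; refuted decls are indexed as negative knowledge (`ledger negatives`).

X_EB (ENTROPY BOOKKEEPING AGAINST THE INVARIANT GIBBS LAW — card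
invariant-gibbs-entropy-bookkeeping; it suffices to show): for local Gibbs data at reduced density σ
< σ₀ and a classical hs-Euler solution Ū = (ρ, ρu, E) on [0,T), the φ-MOLLIFIED empirical fields
U_N(t)⋆φ = (ρ_φ, m_φ, e_φ) of the deterministically evolved hard spheres converge to Ū(t) in L²(𝕋³)
in probability, in the iterated limit N → ∞ then supp φ → {0} (decl CoarseFieldsL2; ρ_φ(z)(x) =
empiricalDensityField z (φ(x − ·)) etc.). CoarseFieldsL2 → HydrodynamicLimit is soft (Assembly:
smoothing of the test function + Cauchy–Schwarz + conservation of the total energy). The content of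
the route is HOW CoarseFieldsL2 is reached: a FINITE-N Dafermos / modulated-ENTROPY Gronwall for
H_φ(t) = ∫ η_σ(U_N(t)⋆φ | Ū(t)) dx on a good event, η_σ(ρ,m,E) = −ρ(3/2 log θ − log ρ −
hsExcessFreeEnergy(ρσ³)) the convex hard-sphere entropy, whose inputs are exactly the ranked cruxes:
(i) the entropy inequality ∫η_σ(U_N(t)⋆φ) ≤ ∫η_σ(Ū(0)) + κ w.h.p. is FREE — Liouville invariance +
energy conservation + the static large-deviation functional of the Gibbs law (MacroSecondLaw, stated
for ARBITRARY Liouville- and energy-preserving measurable maps Ψ_N on the event of a coarse density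
floor: no dynamics in it); (ii) the linear part of H_φ is driven by the mollified-increment closures
MomentumFluxLocality / EnergyFluxLocality (increment of the empirical momentum / energy field tested
against smooth χ = time integral of the hs-Euler flux of the φ-mollified fields tested against ∇χ,
error → 0 in probability as N → ∞ then supp φ → {0}; the mass law is exact microscopically); (iii)
the Gronwall constant is uniform in φ on the event supplied by NoConcentration (coarse density
within a factor c of [inf ρ, sup ρ], coarse energy ≤ c·sup E, uniformly on [0,t] × 𝕋³); (iv)
classical solutions are isentropic (EulerIsentropic). No Young measures, no limit objects, no
microscopic flux definitions: every item is typed over the existing prelude today.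
Lean: Assembly : CoarseFieldsL2 → Literature.MathematicalPhysics.KineticTheory.HydrodynamicLimit,
with CoarseFieldsL2 := ∀ a₀ θ₀ u₀ (continuous, a₀ θ₀ > 0), ∃ σ₀ > 0, ∀ σ ∈ (0,σ₀), ∀ T ρ θ u,
IsHardSphereEulerSolution σ T ρ u θ → ∀ Φ, TendstoHydroFieldsAt (fun N => localGibbsLaw σ a₀ u₀ θ₀ N
(Φ N)) Φ ρ u θ 0 → ∀ t ∈ Set.Ico 0 T, ∀ κ > 0, ∃ r > 0, ∀ φ (Continuous, 0 ≤ φ, ∫ φ = 1, φ = 0 off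
the sup-ball B_r(0)), Tendsto (fun N => localGibbsLaw σ a₀ u₀ θ₀ N (Φ N) {z | κ < ∫ x, (ρ_φ((Φ
N).flow t z) x − ρ t x)^2 + ‖m_φ(…) x − ρ t x • u t x‖^2 + (e_φ(…) x − totalEnergyDensity (ρ t x) (u
t x) (θ t x))^2}) atTop (𝓝 0).
## Assembly
CoarseFieldsL2 → HydrodynamicLimit (item Assembly, provable now). Foreseen layer-2 glue (not filed
at open, D-0019): MacroSecondLaw → MomentumFluxLocality → EnergyFluxLocality → NoConcentration →
EulerIsentropic → CoarseFieldsL2 by the fixed-φ Gronwall H_φ(t) = H_φ(0) + [∫η(U_N(t)⋆φ) −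
∫η(U_N(0)⋆φ)] − [∫η(Ū(t)) − ∫η(Ū(0))] − [L(t) − L(0)], L(τ) = ∫ Dη_σ(Ū(τ))·(U_N(τ)⋆φ − Ū(τ)) dx,
where the first bracket is ≤ κ + o_φ(1) by MacroSecondLaw (Ψ_N = flow t) and Jensen, the second
vanishes by EulerIsentropic, and dL/dτ is computed from the flux cruxes with the smooth multipliers
Dη_σ(Ū) = ((μ̄ − |ū|²/2)/θ̄, ū/θ̄, −1/θ̄) and the Euler equations for Ū, leaving ∫∫ |∇Dη_σ(Ū)|
|Z_σ(U_N⋆φ | Ū)| ≤ C ∫ H_φ on the NoConcentration event (C independent of φ).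

Rationale: WHY THIS LINE. The local Gibbs law is an exponential tilt, LINEAR in the empirical conserved fields,
of the flow-INVARIANT global Gibbs law G_N (Spohn1991 §7.1 (7.16); McLennan/Sasa2014), so entropy
booked against G_N turns the macroscopic second law into a STATIC large-deviation fact
(GeorgiiZessin1993, Georgii1994 LDP + Liouville + energy conservation; RoeckMaesNetocny2006 prove
H-theorems this way GIVEN an autonomous macroscopic equation — here none is assumed), and
Dafermos1979's relative-entropy stability on 𝕋³ consumes only this GLOBAL inequality plus the
conservation laws tested against the smooth multipliers Dη(Ū) (Dafermos2005 §5.2;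
BrezinaFeireisl2018 for the mv variant we avoid). Imported areas: hyperbolic conservation laws
(relative entropy / weak–strong stability) and the mean-field 'modulated energy' technology
(Serfaty2020; HanKwanIacobelli2021 derive Euler from Newton by a finite-N Gronwall against the
smooth solution), transplanted to collisional hard spheres with THERMAL pressure, where the
modulated quantity must be the full mathematical entropy η_σ = −ρs and its inequality must come from
somewhere — it comes free from invariance. Versus route DissipativeWeakStrong (BLOCKED on
Young-measure / flux definitions): same weak–strong spirit, different architecture — finite N,
mollified empirical fields, no measure-valued solutions, no limit objects, admissibility global and
free, every item typed now; it discharges that route's EntropyAdmissibility (stmt-0824) in global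
form and restates its FluxClosure (stmt-0823) in a typed Young-measure-free form. Versus
RelEntropyErgodic/VanishingNoise/ChaoticMixing: no reference local Gibbs state is transported, no
one-block/GibbsErgodicity step, no E_{f_t} of unbounded currents; and LlnImpliesRelEntropy shows
their target 0766 is EQUIVALENT to the conjunct before shocks.
RANKED CRUXES. #2 MacroSecondLaw — for LG data and ANY measurable Liouville- and energy-preserving
maps Ψ_N, P_LG([coarse density ≥ λ everywhere] ∧ ∫η_σ(U(Ψ_N z)⋆φ) > ∫η_σ(Ū(0)) + κ) → 0 (why it
might fail: adversarial Ψ_N exploit any LD-irregularity of the coarse entropy functional — the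
density floor λ removes the one found (isolated cold pairs); Bochner/log/limsup junk at finite N;
sources GeorgiiZessin1993, Georgii1994, RoeckMaesNetocny2006, Sasa2014). Ranked first as the engine
the whole mechanism rests on and the one provable now (plancard rule: unproved input first). #3
MomentumFluxLocality — momentum increments = time-integrated hs-Euler momentum flux of the
φ-mollified fields, N → ∞ then supp φ → 0, pre-shock (why it might fail: it IS local equilibrium of
the momentum current at fixed σ; persistent mesoscopic correlations; Spohn1991 I.3,
OllaVaradhanYau1993 §1; BoltzmannHypothesis barrier). #4 EnergyFluxLocality — same for the energy
field with flux (e_φ + p_φ) m_φ/ρ_φ (why it might fail: cubic velocity moment + vanishing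
Euler-order heat flux; HighMomentumCutoff barrier; OllaVaradhanYau1993 §1, NachtergaeleYau2003
§2.3). #5 NoConcentration — coarse density in [inf ρ/c, c sup ρ] and coarse energy ≤ c sup E
uniformly on [0,t]×𝕋³ w.h.p. (why it might fail: hot spots / dilute fast streams cost finite
entropy, only dynamics excludes them; no maximum principle known).
KILL CRITERIA. ¬MomentumFluxLocality or ¬EnergyFluxLocality for some smooth pre-shock data (averaged
collisional transfer ≠ ρθ(Z−1)𝟙, or a non-vanishing Euler-order heat flux) closes the route and
bears on the conjunct itself (then file ¬HydrodynamicLimitFor). ¬MacroSecondLaw can only come from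
formalisation conventions (it contradicts Liouville + LDP otherwise): restate, do not close.
¬NoConcentration with the flux cruxes intact forces the pivot to the BrezinaFeireisl2018 bookkeeping
(global energy + LOCAL entropy transport), i.e. a new crux 'local second law' — a different route.
NOT DECOMPOSED YET. (a) The layer-2 Gronwall glue cruxes ⇒ CoarseFieldsL2 (see ## Assembly in the
thesis): filed by tenure once a crux closes; it needs the pointwise bounds c|U−Ū|² ≤ η_σ(U|Ū) and
|Z_σ(U|Ū)| ≤ C η_σ(U|Ū) on the NoConcentration state set and C² regularity of hsExcessFreeEnergy on
the packing range visited — HsEosLowDensity (stmt-0768) covers dilute times; dense pre-shock times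
of strongly compressive solutions are the conjunct's shared quantifier caveat (audit D5/Q2; card
implosion-loophole) and are deliberately not attacked here. (b) The static inputs of MacroSecondLaw
(LD upper bound for mollified canonical hard-sphere Gibbs fields at all densities; Laplace
asymptotics N⁻¹log(Z_LG/Z_G) → Λ(P₀) − I(P₀) at low density) ride as --supports lemmas of
MacroSecondLaw. (c) ColemanNollEos (any Galilean-covariant continuous zeroth-order closure
compatible with MacroSecondLaw for all LG data has p = hsPressure, q = 0; card (v)) is filed only if
a prover weakens the flux cruxes to 'some closure'. (d) No definition requests: mollified fields,
η_σ and the fluxes are inlined lets.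
CHEAPEST FALSIFIER. (1) MacroSecondLaw at Ψ = id: ∫η_σ(P₀⋆φ) ≤ ∫η_σ(P₀) by Jensen, and the LD
exponent sup_P[Λ(P) − max(I(P), inf{I(Q): Q ∈ A, E(Q) = E(P)})] − [Λ(P₀) − I(P₀)] = −κ < 0 for a
two-temperature profile (the triage re-derived the identity; a refuter redoes it with the canonical
energy-shell correction and the junk conventions at one-particle windows). (2) Flux cruxes at global
equilibrium (a₀, θ₀ const, u₀ = 0) and for a uniform translation: increments and closure agree in
expectation exactly (stationarity + virial theorem), fluctuations O(N^{-1/2}) — any mismatch there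
kills the typing, not the physics. (3) Re-derive that Dafermos' computation on 𝕋³ uses only d/dt∫η ≤
0 (Dafermos1979 §4) and that the cubic relative energy flux ½ρ|u−ū|²(u−ū)·∇(1/θ̄) is ≤ C η_σ(U|Ū) on
the NoConcentration set.
TWO-LAYER PLAN. Layer 1 = the four cruxes + target + assembly + two supports (8 items). Layer 2
(after a crux closes): glue Bootstrap : MacroSecondLaw → MomentumFluxLocality → EnergyFluxLocality →
NoConcentration → EulerIsentropic → CoarseFieldsL2, possibly split as (RelEntropyCoercivity:
pointwise η_σ/Z_σ bounds on compact dilute state sets) → (FixedMollifierGronwall) → CoarseFieldsL2,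
k ≤ 3.
SUPPORT. EulerIsentropic (classical solutions conserve ∫η_σ where f_ex is C¹: Gibbs relation +
Torus.integral_divergence_eq_zero; provable now). LlnImpliesRelEntropy (hub fact, card (iii): the
conjunct's conclusion at t ⇒ klDiv(lawAt t ‖ matched local Gibbs)/(N+1) → 0, by the exact identity
H(f_t|ψ_a)/N = E_{f_0}Λ₀ − E_{f_t}Λ_a + N⁻¹log(Z_a/Z₀), dominated convergence by the conserved
energy, low-density Laplace asymptotics and EulerIsentropic; so target RelEntropyVanishing stmt-0766
⇔ conjunct pre-shock).
SOURCES. Spohn1991 I.3 and §7.1; Sasa2014; RoeckMaesNetocny2006; GeorgiiZessin1993; Georgii1994;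
Dafermos1979; Dafermos2005 §5.2; BrezinaFeireisl2018; Serfaty2020; HanKwanIacobelli2021;
OllaVaradhanYau1993; Yau1991; NachtergaeleYau2003; LebowitzPenrose1964; Ruelle1969; KipnisLandim1999
Ch. 6.

Novelty: Searched 2026-08-15 (this planner): lit frontier AtomisticToContinuum --since 2020 (30 rows;
weak–strong/relative-entropy descendants of Yau1991 e.g. doi:10.1007/s00205-019-01486-2); lit
bridges --cross any; crossref 'modulated energy Newton Euler particle' → HanKwanIacobelli2021
(doi:10.1090/proc/15349), Serfaty2020 (doi:10.1215/00127094-2020-0019), Bresch–Jabin–Wang modulated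
free energy (doi:10.5802/slsedp.135); crossref 'H-theorems macroscopic autonomous equations' →
RoeckMaesNetocny2006 (doi:10.1007/s10955-006-9079-x); crossref 'weak-strong uniqueness compressible
Euler relative entropy' → Feireisl–Jin–Novotný (doi:10.1007/s00021-011-0091-9), BrezinaFeireisl2018,
Dafermos1979; lit galaxy --star all (daemon queued out twice, 0 rows; logged); plus the card's
searches (Gaspard 2022 (3.40)–(3.47) doi:10.1017/9781108563055, Sasa2014, Goldstein–Lebowitz 2004
doi:10.1016/j.physd.2004.01.008, Spohn1991 (7.16)) and its triage (grade new-combination). Nearest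
prior art: (1) modulated-energy derivations of Euler from Newton — HanKwanIacobelli2021, Serfaty2020
— mean-field/Coulomb scaling, modulated ENERGY against a smooth solution, no thermal pressure, no
entropy; (2) PDE-level relative-entropy stability Dafermos1979 / BrezinaFeireisl2018 (needs an
admissible weak or dissipative mv solution as input); (3) RoeckMaesNetocny2006: Liouville invariance
+ LD ⇒ H-theorem, but conditional on an autonomous macroscopic equation; (4) Yau1991 /
OllaVaradhanYau1993: relative entropy w.r.t. the  [refs: 10.1007/s00205-019-01486-2, 10.1090/proc/15349, 10.1215/00127094-2020-0019, 10.5802/slsedp.135, 10.1007/s10955-006-9079-x, 10.1007/s00021-011-0091-9, 10.1017/9781108563055, 10.1016/j.physd.2004.01.008, doi:10.1007/s00205-019-01486-2, doi:10.1090/proc/15349, doi:10.1215/00127094-2020-0019, doi:10.5802/slsedp.135, doi:10.1007/s10955-006-9079-x, doi:10.1007/s00021-011-0091-9, doi:10.1017/978110856305]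

Barriers (technique_class: relative-entropy modulated-entropy weak-strong LD liouville): - technique_class: relative-entropy modulated-entropy weak-strong-uniqueness large-deviations
liouville-invariance
- Literature.Barriers.AtomisticToContinuum.BoltzmannHypothesisBarrier (and
BoltzmannHypothesisBarrierNarrow): applies to MomentumFluxLocality / EnergyFluxLocality only — they
ARE the local-equilibrium closure, in typed mollified form; it does not apply to MacroSecondLaw,
NoConcentration, the target or the assembly (no one-block replacement, no classification of
stationary states, no transported reference state anywhere). The line does not claim to evade it for
the flux cruxes; the bet is that once admissibility, EOS identification (virial) and entropy
bookkeeping are free, the residual closure is attackable by time-averaging / virialisation over the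
≍N^{1/3} collisions per particle per unit time, which needs no GibbsErgodicity-type theorem.
- Literature.Barriers.AtomisticToContinuum.HighMomentumCutoffBarrier: applies to EnergyFluxLocality
(cubic moment inside its proof) and to NoConcentration (coarse energy bound); evaded in FORM by the
bookkeeping itself — the statements and the Gronwall contain only bounded empirical quantities
(increments of the conserved energy field, mollified fields on the NoConcentration event), never
E_{f_t} of an unbounded current, and MacroSecondLaw needs no moment bound (Gaussian tilt of the
invariant law); NOT evaded in substance for the energy closure, which is why it is isolated as its
own crux (#4).
- Literature.Barriers.AtomisticT

History (route lifecycle, newest last):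
- 2026-08-15T13:42:12Z · CLOSED retired — not-a-thesis: assembly does not conclude the sub-problem Statement (operator:999:1257524)

sub-problem: HydrodynamicLimit · status: closed(retired) · opened planner-plancard-AtomisticToContinuum-Hydrody-237fa1f8-0 2026-08-15T11:34:25Z · rev 1 · ledger route-AtomisticToContinuum-EntropyBookkeeping
GENERATED by the gate from the ledger (D-0016/17). Provers cite these decls: `theorem foo : Summit.AtomisticToContinuum.HydrodynamicLimit.Theses.EntropyBookkeeping.<Decl> := …` in Summits/AtomisticToContinuum/HydrodynamicLimit/Theorems/<Name>.lean.
-/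

namespace Summit.AtomisticToContinuum.HydrodynamicLimit.Theses.EntropyBookkeeping

open scoped BigOperators Topology Manifold Classical MeasureTheory ProbabilityTheory Matrix InnerProductSpace ComplexConjugate ContinuousMap
open Filter Set Function TopologicalSpace MeasureTheory

attribute [summit_statement] _root_.HydrodynamicLimit

/-- item stmt-AtomisticToContinuum-4513 · target · rank 0 · closed · moot by None · by planner
why it might fail: In substance the conjunct itself: deterministic spheres at fixed σ may fail to keep local equilibrium on Euler times (Spohn1991 I.3 p. 44: no dynamical mixing theorem; OllaVaradhanYau1993 Thm 2.1 needs noise).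
sources: Spohn1991 Part I Ch. 3, OllaVaradhanYau1993 §1, Dafermos1979
[target] X_EB: for all continuous profiles ∃σ₀ ∀σ<σ₀ ∀ classical hs-Euler solutions (ρ,u,θ) on [0,T)
∀ flows, if the local Gibbs fields converge at t = 0 then for every t < T and κ > 0 there is r > 0
such that for every continuous kernel φ ≥ 0 with ∫φ = 1 supported in the sup-norm ball B_r(0) of 𝕋³:
P_LG( ∫_𝕋³ (ρ_φ(Φ_t z) − ρ_t)² + ‖m_φ(Φ_t z) − ρ_t u_t‖² + (e_φ(Φ_t z) − E_t)² dx > κ ) → 0, where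
ρ_φ(z)(x) = empiricalDensityField z (φ(x − ·)), m_φ, e_φ likewise (coarse-grained = mollified
empirical fields; inlined lets ρK mK eK). The currency in which the finite-N
Dafermos/modulated-entropy Gronwall pays out; equivalent in strength to the conjunct's conclusion
with uniformity in x (bounded integrands ⇒ HL implies it; Assembly gives the converse). -/
@[route_item "route-AtomisticToContinuum-EntropyBookkeeping"]
def CoarseFieldsL2 : Prop :=
  let ρK : {n : ℕ} → (Literature.MathematicalPhysics.KineticTheory.T3 → ℝ) → Literature.Analysis.FluidPDE.Config (n) (Fin 3) Literature.MathematicalPhysics.KineticTheory.T3 → Literature.MathematicalPhysics.KineticTheory.T3 → ℝ := fun φ z x => Literature.MathematicalPhysics.KineticTheory.empiricalDensityField z (fun y => φ (x - y)); let mK : {n : ℕ} → (Literature.MathematicalPhysics.KineticTheory.T3 → ℝ) → Literature.Analysis.FluidPDE.Config (n) (Fin 3) Literature.MathematicalPhysics.KineticTheory.T3 → Literature.MathematicalPhysics.KineticTheory.T3 → Literature.MathematicalPhysics.KineticTheory.V3 := fun φ z x => Literature.MathematicalPhysics.KineticTheory.empiricalMomentumField z (fun y => φ (x - y)); let eK :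 {n : ℕ} → (Literature.MathematicalPhysics.KineticTheory.T3 → ℝ) → Literature.Analysis.FluidPDE.Config (n) (Fin 3) Literature.MathematicalPhysics.KineticTheory.T3 → Literature.MathematicalPhysics.KineticTheory.T3 → ℝ := fun φ z x => Literature.MathematicalPhysics.KineticTheory.empiricalEnergyField z (fun y => φ (x - y)); ∀ (a₀ θ₀ : Literature.MathematicalPhysics.KineticTheory.T3 → ℝ) (u₀ : Literature.MathematicalPhysics.KineticTheory.T3 → Literature.MathematicalPhysics.KineticTheory.V3), Continuous a₀ → Continuous θ₀ → Continuous u₀ → (∀ x, 0 < a₀ x) → (∀ x, 0 < θ₀ x) → ∃ σ₀ : ℝ, 0 < σ₀ ∧ ∀ σ : ℝ, 0 < σ → σ < σ₀ → ∀ (T : ℝ) (ρ θ : ℝ → Literature.MathematicalPhysics.KineticTheory.T3 → ℝ) (u : ℝ → Literature.MathematicalPhysics.KineticTheory.T3 → Literature.MathematicalPhysics.KineticTheory.V3), Literature.MathematicalPhysics.KineticTheory.IsHardSphereEulerSolution σ T ρ u θ → ∀ Φ : (N : ℕ) → Literature.Analysis.FluidPDE.HardSphereFlow (Literature.Analysis.FluidPDE.Torus.geometry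 (Fin 3)) (Literature.MathematicalPhysics.KineticTheory.hsDiameter σ N) (N + 1), Literature.MathematicalPhysics.KineticTheory.TendstoHydroFieldsAt (fun N => Literature.MathematicalPhysics.KineticTheory.localGibbsLaw σ a₀ u₀ θ₀ N (Φ N)) Φ ρ u θ 0 → ∀ t ∈ Set.Ico 0 T, ∀ κ : ℝ, 0 < κ → ∃ r : ℝ, 0 < r ∧ ∀ φ : Literature.MathematicalPhysics.KineticTheory.T3 → ℝ, Continuous φ → (∀ y, 0 ≤ φ y) → ∫ y, φ y = 1 → (∀ y, r ≤ ‖y‖ → φ y = 0) → Filter.Tendsto (fun N : ℕ => Literature.MathematicalPhysics.KineticTheory.localGibbsLaw σ a₀ u₀ θ₀ N (Φ N) {z | κ < ∫ x, ((ρK φ ((Φ N).flow t z) x - ρ t x) ^ 2 + ‖mK φ ((Φ N).flow t z) x - ρ t x • u t x‖ ^ 2 + (eK φ ((Φ N).flow t z) x - Literature.MathematicalPhysics.KineticTheory.totalEnergyDensity (ρ t x) (u t x) (θ t x)) ^ 2)}) Filter.atTop (nhds 0)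

/-- item stmt-AtomisticToContinuum-4514 · crux · rank 2 · closed · moot by None · by planner
why it might fail: Arbitrary Ψ_N are adversarial: any residual LD-irregularity of the floored coarse-entropy functional (sub-extensive cold clusters, Bochner/log junk: log 0 = 0, ∫ = 0 if non-integrable, f_ex = 0 beyond close packing) would let a Liouville-preserving rearrangement beat the profile-level bound.
sources: GeorgiiZessin1993 (doi:10.1007/bf01192132), Georgii1994, RoeckMaesNetocny2006 (doi:10.1007/s10955-006-9079-x), Sasa2014 (doi:10.1103/physrevlett.112.100602), Spohn1991 §7.1 (7.16), LebowitzPenrose1964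
[crux] MACROSCOPIC SECOND LAW WITHOUT DYNAMICS (card (i)–(ii)): for LG data (a₀,u₀,θ₀) at σ < σ₀
whose fields converge at t = 0 to (ρ₀, ρ₀u₀, E₀ = ρ₀(|u₀|²/2 + 3θ₀/2)), for EVERY sequence of
measurable maps Ψ_N of (N+1)-sphere phase space preserving the Liouville measure of the hard-sphere
domain (MeasurePreserving) and the kinetic energy a.e., every continuous kernel φ ≥ 0 with ∫φ = 1,
every density floor λ > 0 and κ > 0: P_LG( [∀x, ρ_φ(Ψ_N z)(x) ≥ λ] ∧ ∫ η_σ(U(Ψ_N z)⋆φ) dx > ∫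
η_σ(ρ₀, ρ₀u₀, E₀) dx + κ ) → 0, with η_σ(ρ,m,E) = −ρ(3/2 log θ − log ρ − hsExcessFreeEnergy(ρσ³)), θ
= (2/3)(E/ρ − |m|²/2ρ²) — the convex entropy of HsEntropyConvex (stmt-0817) — evaluated on the
φ-mollified empirical fields. Mechanism: dLG/dG_N = e^{NΛ(U_N)}/ratio with Λ LINEAR in the empirical
(density, momentum, energy) fields and G_N (uniform activity, Maxwellian at any θ̄) invariant under
Ψ_N (Liouville + energy); static LD upper bound for the mollified fields under G_N at ALL densities
with rate ∫ i, i = η_σ + E/θ̄ + cρ + const (GeorgiiZessin1993 / Georgii1994-type Gibbs LDP,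
subadditivity; the hard core only helps); Laplace lower bound N⁻¹log(Z_LG/Z_G) → Λ(P₀) − I(P₀) at
low density (LebowitzPenrose1 -/
@[route_item "route-AtomisticToContinuum-EntropyBookkeeping"]
def MacroSecondLaw : Prop :=
  let η : ℝ → ℝ → Literature.MathematicalPhysics.KineticTheory.V3 → ℝ → ℝ := fun σ' ρ' m e => -(ρ' * (3 / 2 * Real.log (2 / 3 * (e / ρ' - ‖m‖ ^ 2 / (2 * ρ' ^ 2))) - Real.log ρ' - Literature.MathematicalPhysics.KineticTheory.hsExcessFreeEnergy (ρ' * σ' ^ 3))); let ρK : {n : ℕ} → (Literature.MathematicalPhysics.KineticTheory.T3 → ℝ) → Literature.Analysis.FluidPDE.Config (n) (Fin 3) Literature.MathematicalPhysics.KineticTheory.T3 → Literature.MathematicalPhysics.KineticTheory.T3 → ℝ := fun φ z x => Literature.MathematicalPhysics.KineticTheory.empiricalDensityField z (fun y => φ (x - y)); let mK : {n : ℕ} → (Literature.MathematicalPhysics.KineticTheory.T3 → ℝ) → Literature.Analysis.FluidPDE.Config (n) (Fin 3) Literature.MathematicalPhysics.KineticTheory.T3 → Literature.MathematicalPhysics.KineticTheory.T3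 → Literature.MathematicalPhysics.KineticTheory.V3 := fun φ z x => Literature.MathematicalPhysics.KineticTheory.empiricalMomentumField z (fun y => φ (x - y)); let eK : {n : ℕ} → (Literature.MathematicalPhysics.KineticTheory.T3 → ℝ) → Literature.Analysis.FluidPDE.Config (n) (Fin 3) Literature.MathematicalPhysics.KineticTheory.T3 → Literature.MathematicalPhysics.KineticTheory.T3 → ℝ := fun φ z x => Literature.MathematicalPhysics.KineticTheory.empiricalEnergyField z (fun y => φ (x - y)); ∀ (a₀ θ₀ : Literature.MathematicalPhysics.KineticTheory.T3 → ℝ) (u₀ : Literature.MathematicalPhysics.KineticTheory.T3 → Literature.MathematicalPhysics.KineticTheory.V3), Continuous a₀ → Continuous θ₀ → Continuous u₀ → (∀ x, 0 < a₀ x) → (∀ x, 0 < θ₀ x) → ∃ σ₀ : ℝ, 0 < σ₀ ∧ ∀ σ : ℝ, 0 < σ → σ < σ₀ → ∀ ρ₀ : Literature.MathematicalPhysics.KineticTheory.T3 → ℝ, Continuous ρ₀ → (∀ x, 0 < ρ₀ x) → ∀ Φ : (N : ℕ) → Literature.Analysis.FluidPDE.HardSphereFlow (Literature.Analysis.FluidPDE.Torus.geometry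 (Fin 3)) (Literature.MathematicalPhysics.KineticTheory.hsDiameter σ N) (N + 1), Literature.MathematicalPhysics.KineticTheory.TendstoHydroFieldsAt (fun N => Literature.MathematicalPhysics.KineticTheory.localGibbsLaw σ a₀ u₀ θ₀ N (Φ N)) Φ (fun _ => ρ₀) (fun _ => u₀) (fun _ => θ₀) 0 → ∀ Ψ : (N : ℕ) → Literature.Analysis.FluidPDE.Config (N + 1) (Fin 3) Literature.MathematicalPhysics.KineticTheory.T3 → Literature.Analysis.FluidPDE.Config (N + 1) (Fin 3) Literature.MathematicalPhysics.KineticTheory.T3, (∀ N, Measurable (Ψ N)) → (∀ N, MeasureTheory.MeasurePreserving (Ψ N) (Literature.Analysis.FluidPDE.liouville (Literature.Analysis.FluidPDE.Torus.geometry (Fin 3)) (N + 1) (Literature.MathematicalPhysics.KineticTheory.hsDiameter σ N)) (Literature.Analysis.FluidPDE.liouville (Literature.Analysis.FluidPDE.Torus.geometry (Fin 3)) (N + 1) (Literature.MathematicalPhysics.KineticTheory.hsDiameter σ N))) → (∀ N, ∀ᵐ z ∂(Literature.Analysis.FluidPDE.liouville (Literature.Analysis.FluidPDE.Torus.geometry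 (Fin 3)) (N + 1) (Literature.MathematicalPhysics.KineticTheory.hsDiameter σ N)), Literature.Analysis.FluidPDE.configEnergy (Ψ N z) = Literature.Analysis.FluidPDE.configEnergy z) → ∀ φ : Literature.MathematicalPhysics.KineticTheory.T3 → ℝ, Continuous φ → (∀ y, 0 ≤ φ y) → ∫ y, φ y = 1 → ∀ lam : ℝ, 0 < lam → ∀ κ : ℝ, 0 < κ → Filter.Tendsto (fun N : ℕ => Literature.MathematicalPhysics.KineticTheory.localGibbsLaw σ a₀ u₀ θ₀ N (Φ N) {z | (∀ x, lam ≤ ρK φ (Ψ N z) x) ∧ (∫ x, η σ (ρ₀ x) (ρ₀ x • u₀ x) (Literature.MathematicalPhysics.KineticTheory.totalEnergyDensity (ρ₀ x) (u₀ x) (θ₀ x))) + κ < ∫ x, η σ (ρK φ (Ψ N z) x) (mK φ (Ψ N z) x) (eK φ (Ψ N z) x)}) Filter.atTop (nhds 0)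

/-- item stmt-AtomisticToContinuum-4515 · crux · rank 3 · closed · moot by None · by planner
why it might fail: It is local equilibrium of the momentum current at fixed σ > 0: persistent mesoscopic position–velocity correlations or sub-resolution structure before T would make the averaged collisional transfer ≠ ρθ(Z−1)𝟙; no mixing theorem for deterministic spheres exists (Spohn1991 I.3 p. 44; OVY93 §1).
sources: Spohn1991 Part I §3.1–3.3, (3.6)–(3.8), (3.15), p. 44, OllaVaradhanYau1993 §1 and Thm 3.10 (doi:10.1007/bf02096727), Literature.Barriers.AtomisticToContinuum.BoltzmannHypothesisBarrierNarrow, KipnisLandim1999 Ch. 6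
[crux] MOMENTUM-FLUX LOCALITY (typed, Young-measure-free form of FluxClosure stmt-0823; card
residual crux R): for LG data, a classical hs-Euler solution on [0,T) whose data they match, 0 ≤ s ≤
t < T, a smooth test function χ (Torus.IsSmooth) and κ > 0 there is r > 0 such that for every
continuous kernel φ ≥ 0, ∫φ = 1, supported in the sup-ball B_r(0): P_LG( ‖ M_N(Φ_t z)(χ) − M_N(Φ_s
z)(χ) − ∫_s^t ∫_𝕋³ [ (m_φ·∇χ) m_φ/ρ_φ + hsPressure σ ρ_φ θ_φ ∇χ ](Φ_τ z, x) dx dτ ‖ > κ ) → 0 as N →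
∞, where M_N = empiricalMomentumField, (ρ_φ, m_φ, e_φ) are the φ-mollified empirical fields and θ_φ
= (2/3)(e_φ/ρ_φ − |m_φ|²/2ρ_φ²) (∇χ = Torus.gradient χ; time integral = Bochner over Set.Ioc s t).
Microscopically dM_N(χ)/dτ = (N+1)⁻¹[Σ_i (v_i·∇χ(x_i)) v_i + Σ_collisions (χ(x_i) − χ(x_j)) Δv_i δ(τ
− τ_c)], both terms O(1); the claim is that at every positive macroscopic resolution their time
integrals are the hs-Euler momentum flux of the coarse-grained state: kinetic part → ρ_φ u_φ⊗u_φ +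
ρ_φθ_φ𝟙 (local-Maxwellian second moments), collisional transfer → excess pressure ρθ(Z(ρσ³) − 1)𝟙
(virial theorem at contact, Spohn1991 I.3 (3.15); Z = hsCompressibility). Time averaging over the ≍
N^{1/3} collisions -/
@[route_item "route-AtomisticToContinuum-EntropyBookkeeping"]
def MomentumFluxLocality : Prop :=
  let ρK : {n : ℕ} → (Literature.MathematicalPhysics.KineticTheory.T3 → ℝ) → Literature.Analysis.FluidPDE.Config (n) (Fin 3) Literature.MathematicalPhysics.KineticTheory.T3 → Literature.MathematicalPhysics.KineticTheory.T3 → ℝ := fun φ z x => Literature.MathematicalPhysics.KineticTheory.empiricalDensityField z (fun y => φ (x - y)); let mK : {n : ℕ} → (Literature.MathematicalPhysics.KineticTheory.T3 → ℝ) → Literature.Analysis.FluidPDE.Config (n) (Fin 3) Literature.MathematicalPhysics.KineticTheory.T3 → Literature.MathematicalPhysics.KineticTheory.T3 → Literature.MathematicalPhysics.KineticTheory.V3 := fun φ z x => Literature.MathematicalPhysics.KineticTheory.empiricalMomentumField z (fun y => φ (x - y)); let eK : {n : ℕ} → (Literature.MathematicalPhysics.KineticTheory.T3 → ℝ) → Literature.Analysis.FluidPDE.Config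 (n) (Fin 3) Literature.MathematicalPhysics.KineticTheory.T3 → Literature.MathematicalPhysics.KineticTheory.T3 → ℝ := fun φ z x => Literature.MathematicalPhysics.KineticTheory.empiricalEnergyField z (fun y => φ (x - y)); let θC : ℝ → Literature.MathematicalPhysics.KineticTheory.V3 → ℝ → ℝ := fun ρ' m e => 2 / 3 * (e / ρ' - ‖m‖ ^ 2 / (2 * ρ' ^ 2)); let momFlux : ℝ → ℝ → Literature.MathematicalPhysics.KineticTheory.V3 → ℝ → Literature.MathematicalPhysics.KineticTheory.V3 → Literature.MathematicalPhysics.KineticTheory.V3 := fun σ' ρ' m e g => (inner ℝ m g / ρ') • m + Literature.MathematicalPhysics.KineticTheory.hsPressure σ' ρ' (θC ρ' m e) • g; ∀ (a₀ θ₀ : Literature.MathematicalPhysics.KineticTheory.T3 → ℝ) (u₀ : Literature.MathematicalPhysics.KineticTheory.T3 → Literature.MathematicalPhysics.KineticTheory.V3), Continuous a₀ → Continuous θ₀ → Continuous u₀ → (∀ x, 0 < a₀ x) → (∀ x, 0 < θ₀ x) → ∃ σ₀ : ℝ, 0 < σ₀ ∧ ∀ σ : ℝ, 0 < σ → σ <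 σ₀ → ∀ (T : ℝ) (ρ θ : ℝ → Literature.MathematicalPhysics.KineticTheory.T3 → ℝ) (u : ℝ → Literature.MathematicalPhysics.KineticTheory.T3 → Literature.MathematicalPhysics.KineticTheory.V3), Literature.MathematicalPhysics.KineticTheory.IsHardSphereEulerSolution σ T ρ u θ → ∀ Φ : (N : ℕ) → Literature.Analysis.FluidPDE.HardSphereFlow (Literature.Analysis.FluidPDE.Torus.geometry (Fin 3)) (Literature.MathematicalPhysics.KineticTheory.hsDiameter σ N) (N + 1), Literature.MathematicalPhysics.KineticTheory.TendstoHydroFieldsAt (fun N => Literature.MathematicalPhysics.KineticTheory.localGibbsLaw σ a₀ u₀ θ₀ N (Φ N)) Φ ρ u θ 0 → ∀ s t : ℝ, 0 ≤ s → s ≤ t → t < T → ∀ χ : Literature.MathematicalPhysics.KineticTheory.T3 → ℝ, Literature.Analysis.FunctionSpaces.Torus.IsSmooth χ → ∀ κ : ℝ, 0 < κ → ∃ r : ℝ, 0 < r ∧ ∀ φ : Literature.MathematicalPhysics.KineticTheory.T3 → ℝ, Continuous φ → (∀ y, 0 ≤ φ y) → ∫ y, φ y = 1 → (∀ y, r ≤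 ‖y‖ → φ y = 0) → Filter.Tendsto (fun N : ℕ => Literature.MathematicalPhysics.KineticTheory.localGibbsLaw σ a₀ u₀ θ₀ N (Φ N) {z | κ < ‖Literature.MathematicalPhysics.KineticTheory.empiricalMomentumField ((Φ N).flow t z) χ - Literature.MathematicalPhysics.KineticTheory.empiricalMomentumField ((Φ N).flow s z) χ - ∫ τ in Set.Ioc s t, ∫ x, momFlux σ (ρK φ ((Φ N).flow τ z) x) (mK φ ((Φ N).flow τ z) x) (eK φ ((Φ N).flow τ z) x) (Literature.Analysis.FunctionSpaces.Torus.gradient χ x)‖}) Filter.atTop (nhds 0)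

/-- item stmt-AtomisticToContinuum-4516 · crux · rank 4 · closed · moot by None · by planner
why it might fail: Needs control of the cubic velocity moment along f_t (uncontrolled for |v|²/2: HighMomentumCutoff barrier, OVY93 §1, Nachtergaele–Yau II.1 'no proof') AND vanishing Euler-order heat flux (local equilibrium of the energy current) at fixed σ.
sources: OllaVaradhanYau1993 §1, (2.2)(iii), NachtergaeleYau2003 §2.3 Assumption II.1, Literature.Barriers.AtomisticToContinuum.HighMomentumCutoffBarrier, Spohn1991 Part I §3.1 (3.6)–(3.8)
[crux] ENERGY-FLUX LOCALITY (the HighMomentumCutoff-carrying half of the closure; card 'tail lemma'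
absorbed): same setting and quantifiers as MomentumFluxLocality, for the empirical ENERGY field E_N
= empiricalEnergyField: P_LG( | E_N(Φ_t z)(χ) − E_N(Φ_s z)(χ) − ∫_s^t ∫_𝕋³ (e_φ + hsPressure σ ρ_φ
θ_φ)(m_φ·∇χ)/ρ_φ (Φ_τ z, x) dx dτ | > κ ) → 0, i.e. the time-integrated microscopic energy current
(kinetic part (N+1)⁻¹Σ_i (v_i·∇χ)|v_i|²/2, a CUBIC velocity moment, plus collisional energy
transfer) is, at every positive macroscopic resolution, the hs-Euler enthalpy flux (E + p)u of the
coarse-grained state with ZERO Euler-order heat flux. The statement itself contains only bounded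
quantities (increments of the energy field ≤ total energy); the cubic tail (OllaVaradhanYau1993 §1
modified the kinetic energy to avoid it; NachtergaeleYau2003 Assumption II.1) lives inside its proof
— this is where a time-integrated fast-particle estimate (cards apriori-tails-and-rattlers /
fast-particle-energy-cascade) would be consumed. [deps: none] [difficulty: open-problem] -/
@[route_item "route-AtomisticToContinuum-EntropyBookkeeping"]
def EnergyFluxLocality : Prop :=
  let ρK : {n : ℕ} → (Literature.MathematicalPhysics.KineticTheory.T3 → ℝ) → Literature.Analysis.FluidPDE.Config (n) (Fin 3) Literature.MathematicalPhysics.KineticTheory.T3 → Literature.MathematicalPhysics.KineticTheory.T3 → ℝ := fun φ z x => Literature.MathematicalPhysics.KineticTheory.empiricalDensityField z (fun y => φ (x - y)); let mK : {n : ℕ} → (Literature.MathematicalPhysics.KineticTheory.T3 → ℝ) → Literature.Analysis.FluidPDE.Config (n) (Fin 3) Literature.MathematicalPhysics.KineticTheory.T3 → Literature.MathematicalPhysics.KineticTheory.T3 → Literature.MathematicalPhysics.KineticTheory.V3 := fun φ z x => Literature.MathematicalPhysics.KineticTheory.empiricalMomentumField z (fun y => φ (x - y)); let eK : {n : ℕ}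 → (Literature.MathematicalPhysics.KineticTheory.T3 → ℝ) → Literature.Analysis.FluidPDE.Config (n) (Fin 3) Literature.MathematicalPhysics.KineticTheory.T3 → Literature.MathematicalPhysics.KineticTheory.T3 → ℝ := fun φ z x => Literature.MathematicalPhysics.KineticTheory.empiricalEnergyField z (fun y => φ (x - y)); let θC : ℝ → Literature.MathematicalPhysics.KineticTheory.V3 → ℝ → ℝ := fun ρ' m e => 2 / 3 * (e / ρ' - ‖m‖ ^ 2 / (2 * ρ' ^ 2)); let enFlux : ℝ → ℝ → Literature.MathematicalPhysics.KineticTheory.V3 → ℝ → Literature.MathematicalPhysics.KineticTheory.V3 → ℝ := fun σ' ρ' m e g => (e + Literature.MathematicalPhysics.KineticTheory.hsPressure σ' ρ' (θC ρ' m e)) / ρ' * inner ℝ m g; ∀ (a₀ θ₀ : Literature.MathematicalPhysics.KineticTheory.T3 → ℝ) (u₀ : Literature.MathematicalPhysics.KineticTheory.T3 → Literature.MathematicalPhysics.KineticTheory.V3), Continuous a₀ → Continuous θ₀ → Continuous u₀ → (∀ x, 0 < a₀ x) → (∀ x, 0 < θ₀ x) → ∃ σ₀ : ℝ, 0 < σ₀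 ∧ ∀ σ : ℝ, 0 < σ → σ < σ₀ → ∀ (T : ℝ) (ρ θ : ℝ → Literature.MathematicalPhysics.KineticTheory.T3 → ℝ) (u : ℝ → Literature.MathematicalPhysics.KineticTheory.T3 → Literature.MathematicalPhysics.KineticTheory.V3), Literature.MathematicalPhysics.KineticTheory.IsHardSphereEulerSolution σ T ρ u θ → ∀ Φ : (N : ℕ) → Literature.Analysis.FluidPDE.HardSphereFlow (Literature.Analysis.FluidPDE.Torus.geometry (Fin 3)) (Literature.MathematicalPhysics.KineticTheory.hsDiameter σ N) (N + 1), Literature.MathematicalPhysics.KineticTheory.TendstoHydroFieldsAt (fun N => Literature.MathematicalPhysics.KineticTheory.localGibbsLaw σ a₀ u₀ θ₀ N (Φ N)) Φ ρ u θ 0 → ∀ s t : ℝ, 0 ≤ s → s ≤ t → t < T → ∀ χ : Literature.MathematicalPhysics.KineticTheory.T3 → ℝ, Literature.Analysis.FunctionSpaces.Torus.IsSmooth χ → ∀ κ : ℝ, 0 < κ → ∃ r : ℝ, 0 < r ∧ ∀ φ : Literature.MathematicalPhysics.KineticTheory.T3 → ℝ, Continuous φ → (∀ y, 0 ≤ φ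 y) → ∫ y, φ y = 1 → (∀ y, r ≤ ‖y‖ → φ y = 0) → Filter.Tendsto (fun N : ℕ => Literature.MathematicalPhysics.KineticTheory.localGibbsLaw σ a₀ u₀ θ₀ N (Φ N) {z | κ < |Literature.MathematicalPhysics.KineticTheory.empiricalEnergyField ((Φ N).flow t z) χ - Literature.MathematicalPhysics.KineticTheory.empiricalEnergyField ((Φ N).flow s z) χ - ∫ τ in Set.Ioc s t, ∫ x, enFlux σ (ρK φ ((Φ N).flow τ z) x) (mK φ ((Φ N).flow τ z) x) (eK φ ((Φ N).flow τ z) x) (Literature.Analysis.FunctionSpaces.Torus.gradient χ x)|}) Filter.atTop (nhds 0)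

/-- item stmt-AtomisticToContinuum-4517 · crux · rank 5 · closed · moot by None · by planner
why it might fail: A macroscopic hot spot, dilute fast stream or coarse vacuum before T costs only finite entropy (affordable for far-from-equilibrium data), so only dynamics excludes it; no a-priori maximum principle for coarse temperature/velocity of deterministic spheres is known (cf. stmt-0781).
sources: Dafermos1979 §4 (L^∞ class of weak solutions), OllaVaradhanYau1993 §1 (large velocities), Literature.Barriers.AtomisticToContinuum.HighMomentumCutoffBarrier
[crux] NO COARSE-GRAINED CONCENTRATION OR VACUUM BEFORE T: for LG data, a matched classical solution
(ρ,u,θ) on [0,T), t < T, c > 1 and every continuous kernel φ ≥ 0 with ∫φ = 1: P_LG( ∃ τ ∈ [0,t] ∃ x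
∈ 𝕋³: ρ_φ(Φ_τ z)(x) < ρ(τ′,x′)/c for all (τ′,x′) ∈ [0,t]×𝕋³ [coarse density below inf ρ/c] ∨ ρ_φ(Φ_τ
z)(x) > c ρ(τ′,x′) for all (τ′,x′) [above c sup ρ] ∨ e_φ(Φ_τ z)(x) > c E(τ′,x′) for all (τ′,x′)
[coarse energy above c sup E] ) → 0. Weaker than the conclusion (identifies nothing) but UNIFORM in
(τ,x) ∈ [0,t]×𝕋³; it is what makes the layer-2 Gronwall constants uniform in the mollifier: on its
complement the coarse state stays in a compact set (density in [inf ρ/c, c sup ρ], velocity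
|m_φ|/ρ_φ ≤ (2c² sup E/inf ρ)^{1/2} by Cauchy–Schwarz, temperature ≤ (2/3)c² sup E/inf ρ, packing ≤
c sup ρ σ³) on which η_σ(·|Ū) is uniformly convex and the relative fluxes, including the cubic
½ρ|u−ū|²(u−ū), are ≤ C η_σ(·|Ū) (Dafermos1979 works in exactly such an L^∞ class). Any fixed φ is
allowed (φ ≡ 1 gives ρ_φ ≡ 1, e_φ = total energy). [deps: none] [difficulty: L–open] -/
@[route_item "route-AtomisticToContinuum-EntropyBookkeeping"]
def NoConcentration : Prop :=
  let ρK : {n : ℕ} → (Literature.MathematicalPhysics.KineticTheory.T3 → ℝ) → Literature.Analysis.FluidPDE.Config (n) (Fin 3) Literature.MathematicalPhysics.KineticTheory.T3 → Literature.MathematicalPhysics.KineticTheory.T3 → ℝ := fun φ z x => Literature.MathematicalPhysics.KineticTheory.empiricalDensityField z (fun y => φ (x - y)); let eK : {n : ℕ} → (Literature.MathematicalPhysics.KineticTheory.T3 → ℝ) → Literature.Analysis.FluidPDE.Config (n) (Fin 3) Literature.MathematicalPhysics.KineticTheory.T3 → Literature.MathematicalPhysics.KineticTheory.T3 → ℝ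 := fun φ z x => Literature.MathematicalPhysics.KineticTheory.empiricalEnergyField z (fun y => φ (x - y)); ∀ (a₀ θ₀ : Literature.MathematicalPhysics.KineticTheory.T3 → ℝ) (u₀ : Literature.MathematicalPhysics.KineticTheory.T3 → Literature.MathematicalPhysics.KineticTheory.V3), Continuous a₀ → Continuous θ₀ → Continuous u₀ → (∀ x, 0 < a₀ x) → (∀ x, 0 < θ₀ x) → ∃ σ₀ : ℝ, 0 < σ₀ ∧ ∀ σ : ℝ, 0 < σ → σ < σ₀ → ∀ (T : ℝ) (ρ θ : ℝ → Literature.MathematicalPhysics.KineticTheory.T3 → ℝ) (u : ℝ → Literature.MathematicalPhysics.KineticTheory.T3 → Literature.MathematicalPhysics.KineticTheory.V3), Literature.MathematicalPhysics.KineticTheory.IsHardSphereEulerSolution σ T ρ u θ → ∀ Φ : (N : ℕ) → Literature.Analysis.FluidPDE.HardSphereFlow (Literature.Analysis.FluidPDE.Torus.geometry (Fin 3)) (Literature.MathematicalPhysics.KineticTheory.hsDiameter σ N) (N + 1), Literature.MathematicalPhysics.KineticTheory.TendstoHydroFieldsAt (fun N => Literature.MathematicalPhysics.KineticTheory.localGibbsLaw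 σ a₀ u₀ θ₀ N (Φ N)) Φ ρ u θ 0 → ∀ t ∈ Set.Ico 0 T, ∀ c : ℝ, 1 < c → ∀ φ : Literature.MathematicalPhysics.KineticTheory.T3 → ℝ, Continuous φ → (∀ y, 0 ≤ φ y) → ∫ y, φ y = 1 → Filter.Tendsto (fun N : ℕ => Literature.MathematicalPhysics.KineticTheory.localGibbsLaw σ a₀ u₀ θ₀ N (Φ N) {z | ∃ τ ∈ Set.Icc 0 t, ∃ x : Literature.MathematicalPhysics.KineticTheory.T3, (∀ τ' ∈ Set.Icc 0 t, ∀ x' : Literature.MathematicalPhysics.KineticTheory.T3, c * ρK φ ((Φ N).flow τ z) x < ρ τ' x') ∨ (∀ τ' ∈ Set.Icc 0 t, ∀ x' : Literature.MathematicalPhysics.KineticTheory.T3, c * ρ τ' x' < ρK φ ((Φ N).flow τ z) x) ∨ (∀ τ' ∈ Set.Icc 0 t, ∀ x' : Literature.MathematicalPhysics.KineticTheory.T3, c * Literature.MathematicalPhysics.KineticTheory.totalEnergyDensity (ρ τ' x') (u τ' x') (θ τ' x') < eK φ ((Φ N).flow τ z) x)}) Filter.atTop (nhds 0)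

/-- item stmt-AtomisticToContinuum-4518 · support · rank 9 · closed · moot by None · by planner
[support] CLASSICAL hs-EULER SOLUTIONS ARE ISENTROPIC WHERE THE EOS IS C¹: if 0 < η₀, F is C¹ on
(−η₀, η₀) (ContDiffOn) and agrees with hsExcessFreeEnergy on [0, η₀), then for every σ > 0 and every
IsHardSphereEulerSolution σ T ρ u θ with ρ(t,x)σ³ < η₀ on [0,T)×𝕋³, ∫ −ρ_t(3/2 log θ_t − log ρ_t −
hsExcessFreeEnergy(ρ_tσ³)) dx = the same at t = 0, for all t ∈ [0,T). Proof: on the open interval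
deriv hsExcessFreeEnergy = F′, so hsPressure = ρθ(1 + ρσ³F′(ρσ³)) and the Gibbs relation θ ds = de +
p d(1/ρ) with e = 3θ/2, s = 3/2 log θ − log ρ − F(ρσ³) holds exactly; the three PDEs of
IsHardSphereEulerSolution then give ∂_t(ρs) + div(ρsu) = 0 pointwise (chain rule with the smooth
slices, Torus.IsSmoothSpaceTimeOn); integrate over 𝕋³
(Literature.Analysis.FunctionSpaces.Torus.integral_divergence_eq_zero), differentiate under the
integral (compact torus, continuous integrands) and conclude from a vanishing timeDerivWithin on Ico
0 T that the integral is constant. Needed by the layer-2 Gronwall (∫η_σ(Ū(t)) = ∫η_σ(Ū(0))) and by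
LlnImpliesRelEntropy; F comes from HsEosLowDensity (stmt-0768, route RelEntropyErgodic) in the
dilute window. [deps: none] [difficulty: M, provable-now] -/
@[route_item "route-AtomisticToContinuum-EntropyBookkeeping"]
def EulerIsentropic : Prop :=
  ∀ (η₀ : ℝ) (F : ℝ → ℝ), 0 < η₀ → ContDiffOn ℝ 1 F (Set.Ioo (-η₀) η₀) → Set.EqOn Literature.MathematicalPhysics.KineticTheory.hsExcessFreeEnergy F (Set.Ico 0 η₀) → ∀ (σ T : ℝ) (ρ θ : ℝ → Literature.MathematicalPhysics.KineticTheory.T3 → ℝ) (u : ℝ → Literature.MathematicalPhysics.KineticTheory.T3 → Literature.MathematicalPhysics.KineticTheory.V3), 0 < σ → Literature.MathematicalPhysics.KineticTheory.IsHardSphereEulerSolution σ T ρ u θ → (∀ t ∈ Set.Ico 0 T, ∀ x, ρ t x * σ ^ 3 < η₀) → ∀ t ∈ Set.Ico 0 T, ∫ x, -(ρ t x * (3 / 2 * Real.log (θ t x) - Real.log (ρ t x) - Literature.MathematicalPhysics.KineticTheory.hsExcessFreeEnergy (ρ t x * σ ^ 3))) = ∫ x, -(ρ 0 x * (3 / 2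 * Real.log (θ 0 x) - Real.log (ρ 0 x) - Literature.MathematicalPhysics.KineticTheory.hsExcessFreeEnergy (ρ 0 x * σ ^ 3)))

/-- item stmt-AtomisticToContinuum-4519 · support · rank 9 · closed · moot by None · by planner
[support] HUB FACT (card (iii)): THE CONJUNCT'S CONCLUSION IMPLIES YAU'S RELATIVE-ENTROPY FORM. For
all continuous profiles ∃ η₀, σ₀ > 0 such that for σ < σ₀, every classical solution (ρ,u,θ) on [0,T)
with packing ρσ³ < η₀, every flow family Φ with LG fields converging at t = 0: if the LG fields ALSO
converge at time t < T (TendstoHydroFieldsAt … t, i.e. the conclusion of HydrodynamicLimitFor at t),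
then there is a continuous activity profile a > 0 such that the matched local Gibbs laws λ_t^N =
localGibbsLaw σ a (u t) (θ t) N (Φ N) are probability measures and klDiv(lawAt (Φ N) (LG_N) t ‖
λ_t^N)/(N+1) → 0 (Yau1991 form; the converse of RelEntropyErgodic's Assembly stmt-0769). Proof
sketch: exact bookkeeping identity H(f_t|ψ_a)/N = E_{f_0}Λ₀(U) − E_{f_t}Λ_a(U) + N⁻¹log(Z_a/Z₀)
(G_N-invariance of the flow, f_t = f_0∘Φ_{−t}, tilts linear in the empirical fields); the two
expectations converge by the LLN at 0 and at t with domination by the conserved total energy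
(dominated convergence, configEnergy_eq_holds); N⁻¹log Z → Λ(P) − I(P) by low-density Laplace
asymptotics for both LG states (LebowitzPenrose1964, Ruelle1969; a = the activity profile
reproducing ρ_t at θ_t, dilute window η₀); -/
@[route_item "route-AtomisticToContinuum-EntropyBookkeeping"]
def LlnImpliesRelEntropy : Prop :=
  ∀ (a₀ θ₀ : Literature.MathematicalPhysics.KineticTheory.T3 → ℝ) (u₀ : Literature.MathematicalPhysics.KineticTheory.T3 → Literature.MathematicalPhysics.KineticTheory.V3), Continuous a₀ → Continuous θ₀ → Continuous u₀ → (∀ x, 0 < a₀ x) → (∀ x, 0 < θ₀ x) → ∃ η₀ : ℝ, 0 < η₀ ∧ ∃ σ₀ : ℝ, 0 < σ₀ ∧ ∀ σ : ℝ, 0 < σ → σ < σ₀ → ∀ (T : ℝ) (ρ θ : ℝ → Literature.MathematicalPhysics.KineticTheory.T3 → ℝ) (u : ℝ → Literature.MathematicalPhysics.KineticTheory.T3 → Literature.MathematicalPhysics.KineticTheory.V3), Literature.MathematicalPhysics.KineticTheory.IsHardSphereEulerSolution σ T ρ u θ → (∀ t ∈ Set.Ico 0 T, ∀ x, ρ t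 x * σ ^ 3 < η₀) → ∀ Φ : (N : ℕ) → Literature.Analysis.FluidPDE.HardSphereFlow (Literature.Analysis.FluidPDE.Torus.geometry (Fin 3)) (Literature.MathematicalPhysics.KineticTheory.hsDiameter σ N) (N + 1), Literature.MathematicalPhysics.KineticTheory.TendstoHydroFieldsAt (fun N => Literature.MathematicalPhysics.KineticTheory.localGibbsLaw σ a₀ u₀ θ₀ N (Φ N)) Φ ρ u θ 0 → ∀ t ∈ Set.Ico 0 T, Literature.MathematicalPhysics.KineticTheory.TendstoHydroFieldsAt (fun N => Literature.MathematicalPhysics.KineticTheory.localGibbsLaw σ a₀ u₀ θ₀ N (Φ N)) Φ ρ u θ t → ∃ a : Literature.MathematicalPhysics.KineticTheory.T3 → ℝ, Continuous a ∧ (∀ x, 0 < a x) ∧ (∀ N, MeasureTheory.IsProbabilityMeasure (Literature.MathematicalPhysics.KineticTheory.localGibbsLaw σ a (u t) (θ t) N (Φ N))) ∧ Filter.Tendsto (fun N : ℕ => InformationTheory.klDiv ((Φ N).lawAt (Literature.MathematicalPhysics.KineticTheory.localGibbsLaw σ a₀ u₀ θ₀ N (Φ N)) t) (Literature.MathematicalPhysics.KineticTheory.localGibbsLaw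 σ a (u t) (θ t) N (Φ N)) / ((N : ENNReal) + 1)) Filter.atTop (nhds 0)

/-- item stmt-AtomisticToContinuum-4520 · assembly · rank 1 · closed · moot by None · by planner
[assembly] CoarseFieldsL2 → HydrodynamicLimit: take σ₀ from CoarseFieldsL2; fix σ, a classical
solution, Φ, the t = 0 hypothesis, t < T, a continuous χ and δ > 0. For a kernel φ supported in B_r
write U_N(t)(χ) − ∫χŪ(t) = U_N(t)(χ − χ_r) + ∫ (U_N(t)⋆φ − Ū(t))(x) χ(x) dx with χ_r(y) = ∫ φ(x −
y)χ(x) dx (Fubini for the finite empirical sum; ∫φ = 1). First term ≤ sup|χ − χ_r| · (1 + energy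
field of the constant 1), where sup|χ − χ_r| ≤ modulus of continuity of χ at scale r (uniform
continuity on the compact torus) and the energy field of 1 at time t equals the one at time 0 for
LG-a.e. z (IsHardSphereTrajectory.configEnergy_eq_holds on Φ.good, HardSphereFlow.ae_mem_good,
localGibbsLaw = particleLaw ≪ liouville), which is tight by the t = 0 hypothesis with χ = 1
(momentum: ‖m(χ)‖ ≤ ‖χ‖_∞(1 + 2·energy)). Second term ≤ ‖χ‖_{L²} · (the CoarseFieldsL2
integral)^{1/2} by Cauchy–Schwarz. Choose r, then N. Measures of arbitrary sets are monotone and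
subadditive (outer measure), so no measurability of the deviation sets is needed; an admissible
continuous kernel in B_r exists on UnitAddTorus (Fin 3) (normalise (r/2 − ‖y‖)₊, continuous,
volume-positive support). [difficulty: M, provable-now] -/
@[route_item "route-AtomisticToContinuum-EntropyBookkeeping"]
def Assembly : Prop :=
  CoarseFieldsL2 → Literature.MathematicalPhysics.KineticTheory.HydrodynamicLimit

end Summit.AtomisticToContinuum.HydrodynamicLimit.Theses.EntropyBookkeeping
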